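import Summits.QuantumFields.YangMills.Theorems.UnitScaleTiltProp7KinvPiFamilyPackage
import Summits.QuantumFields.YangMills.Theorems.UnitScaleTiltProp7Kernel133OfPiBlockLetters
import Summits.QuantumFields.YangMills.Theorems.UnitScaleTiltProp7Kernel137DoorOfKinvEntry
import HarnessLib

/-!
# Route `UnitScaleTilt`, crux K1 «MinimiserStabilityRegPr» (stmt-QuantumFields-19200), EX face — THE S47 ROW `h133` AS ONE `∃`-PACKAGE (K6-h133):
# **print's (3.133) «`|H(b, y)| ≤ O(1)e^{−δ₁d}`» FOR `H_π = G_πQ_k†(Q_kG_πQ_k†)⁻¹`, FOR ALL MEMBERS, WITH L-ONLY CONSTANTS** — px10 g13's H-DOOR ✓p769611 §4 fed the Π-closure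
# ✓`Prop7KinvPiFamilyPackage.kinvRow_pi_family_exists` and px16's ✓`Prop7GreenPiBlockFamilyPackage.hGblk_pi_family_exists` (conj 1), rates aligned by the H-KNIT's toolkit

Cell `ym3-torus` (HUMAN RULING D-0037; rung R3 = SU(2) YM₃ on T³ — NOT d = 4, NOT infinite volume, NOT a mass gap, NOT Clay).  Width seat `ym3-torus-px10` (gen 14; FREE px).
THEOREMS ONLY (0 `def`, 0 `sorry`, default heartbeats); `--supports stmt-QuantumFields-19200 --as helper`; count-neutral.

INPUTS BY NAME.  (K6-Π) `kinvRow_pi_family_exists` → `αPi CPi μPi` + the `hKinv`(Π) family; (GΠ-PKG) `hGblk_pi_family_exists` → `αP CP KP δP` + the `hGblk`(Π) family (conj 1); (γ)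
✓`hco_DeltaPiSlotP_exists` + ✓`posOnto_of_coercive` → `PosOnto`(Δ_πᴾ); common rate `δ L := min (μPi L) (δP L)` (✓`coarseRow_mono_rate`, ✓`blockLetter_mono_rate`); cap `αH := min (min αPi αP) αcp`;
the door on the CLAMPED coupling function with `Λ := Lift ∧ ROOM` (as K6-η∕K6-Π).
WHAT IS PROVED (ns `Summit.QuantumFields.YangMills.Theorems.Prop7H133FamilyPackage`).
* ★★★ `h137kpi_family_exists` — the S47 ROW TEXT of `h137kπ` likewise: ✓p769218 §4 `kernel137_family_of_kinvRow` ∘ K6-Π, pin `a ≤ a₁·((c₀ L∕cB L)·ℓ³)` = the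
  window's upper edge, `c137 L := 1920·e^{μPi L+1}·(CPi L + a₁)`, rate `μPi L`.
* ★★★ `h133_family_exists` — THERE ARE L-only `αH CH δH : ℕ → ℝ` (cap with the three windows of record and `≤ 1`, `0 ≤ CH`, `0 < δH`) such that for every `L > 1`, member `i`, background
  `U₀` with `RegPr ρ U₀`, `ρ ≤ αH L`, under `Lift`, `ROOM` and the coupling window `a₀(c₀ L∕cB L)ℓ³ ≤ a ≤ a₁(c₀ L∕cB L)ℓ³`: THE S47 ROW TEXT of `h133` —
  `‖flat115 (H1f … a (DeltaPiSlotP … a) U₀ (δ_y ⊗ Z)) b′‖ ≤ CH L·e^{−(δH L∕2)·tdist(B((bondEquiv)⁻¹b′)₋, ŷ)}·‖Z‖` (`CH L = 1920·e^{δ L+1}·CPi L·CP L·(2(1+2∕δ L))³`, `δH := δ`, NO `η`-power).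
  So census row (1) is, BY KERNEL, a function of {RegPr∕cap, Lift, ROOM, coupling window} ONLY — every analytic letter discharged by the landed K-storey ∕ N6 ∕ (γ) ∕ (Gb)(Db)(c·b) files.
HONEST SCOPE.  An `∃`-assembly; no estimate of print is proved HERE; `h133` is ONE of S47's rows — nothing of the other rows, EX or the crux is proved; the Yang–Mills mass gap is NOT proved.

References: T. Bałaban, CMP **99** (1985) 389–434 [Balaban1985BackgroundPropagators] ((3.133) p.422, Thm 3.12 p.423, (3.126) p.420, (3.132) p.422); CMP **102** (1985) 277–309
[Balaban1985Variational] ((45)–(46) p.285, (103) p.293, (133) p.298, Thm 1 p.279).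
-/

set_option autoImplicit false

noncomputable section

open scoped BigOperators Matrix.Norms.L2Operator InnerProductSpace ComplexConjugate

namespace Summit.QuantumFields.YangMills.Theorems.Prop7H133FamilyPackage

open Literature.MathematicalPhysics.QuantumFieldTheory.Balaban1983to89
open Literature.MathematicalPhysics.QuantumFieldTheory.Balaban1983to89.T3ContinuumYM3Torus
open Literature.MathematicalPhysics.QuantumFieldTheory.Balaban1983to89.T3Thm1Carrier
open T3PrintedRegularMinimiser (RegPr)
open T3PrintedMinimiserExistence (regPr_mono)
open T3PrintedRegularOrbits (sites_eq)
open T3LevelShift (siteShift)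
open T3SectALandauChart (bgUnits)
open B15DeterminingSets (embIter)
open B9SectCLatticeCarrier (Bond)
open B9Eq311L2Pairing (WL2)
open B11Eq103H1Complex (BondL2K)
open B11Eq90V0primeCurrent (flat115)
open B5Eq118OneStroke (iterBlockOf)
open Summit.QuantumFields.YangMills.Theorems.Prop8Chart (emlIterU)
open Summit.QuantumFields.YangMills.Theorems.Prop7SectET3Transport (periodsT3 bondEquiv)
open Summit.QuantumFields.YangMills.Theorems.Prop7SectET3HilbertLetters (W₂ toL2 toL2B)
open Summit.QuantumFields.YangMills.Theorems.Prop7SectET3CurvedPropagators (Qk GT KinvT H1f PosOnto)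
open Summit.QuantumFields.YangMills.Theorems.Prop7SectET3DeltaPiPInv (DeltaPiSlotP)
open Summit.QuantumFields.YangMills.Theorems.Prop7OneFormCoerciveHolds (hco_DeltaPiSlotP_exists posOnto_of_coercive)
open Summit.QuantumFields.YangMills.Theorems.Prop7Kernel133DoorOfKinvRow (kernel133_family_of_kinvRow_of_greenBlockSup)
open Summit.QuantumFields.YangMills.Theorems.Prop7Kernel133OfPiBlockLetters (blockLetter_mono_rate coarseRow_mono_rate)
open Summit.QuantumFields.YangMills.Theorems.Prop7KinvPiFamilyPackage (kinvRow_pi_family_exists)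
open Summit.QuantumFields.YangMills.Theorems.Prop7GreenPiBlockFamilyPackage (hGblk_pi_family_exists)
open Summit.QuantumFields.YangMills.Theorems.Prop7Kernel137DoorOfKinvEntry (kernel137_family_of_kinvRow)

/-- ★★★ **THE S47 ROW `h133` FOR ALL MEMBERS AS ONE `∃`-PACKAGE** (cap `αH`, constant `CH L`, rate `δH L∕2`; thread `Lift ∧ ROOM ∧` coupling window) — H-DOOR ✓p769611 §4 ∘ {K6-Π, GΠ-PKG conj 1,
(γ)}, rates aligned to `δ := min μPi δP`. [cite: Balaban1985BackgroundPropagators, (3.133) p.422, Thm 3.12 p.423; Balaban1985Variational, (103) p.293, (133) p.298] -/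
theorem h133_family_exists [hFL : ∀ F : T3Family, Fact (0 < (F.L : ℝ))] [hFη : ∀ (F : T3Family) (k : ℕ), Fact (0 < ((F.L : ℝ)⁻¹) ^ k)]
    (c₀ cB : ℕ → ℝ) [hc₀ : ∀ L : ℕ, Fact (0 < c₀ L)] [hcB : ∀ L : ℕ, Fact (0 < cB L)] {a₀ a₁ : ℝ} (ha₀ : 0 < a₀) (ha₀₁ : a₀ ≤ a₁) :
    ∃ (αH CH δH : ℕ → ℝ),
      (∀ L : ℕ, 1 < L → 0 < αH L) ∧ (∀ L : ℕ, 1 < L → 10 ^ 12 * (L : ℝ) ^ 3 * αH L ≤ 1) ∧ (∀ L : ℕ, 1 < L → 10 ^ 10 * (L : ℝ) ^ 6 * αH L ≤ 1) ∧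
      (∀ L : ℕ, 1 < L → 13 * 10 ^ 14 * (L : ℝ) ^ 3 * αH L ≤ 1) ∧ (∀ L : ℕ, 1 < L → αH L ≤ 1) ∧ (∀ L : ℕ, 1 < L → 0 ≤ CH L) ∧ (∀ L : ℕ, 1 < L → 0 < δH L) ∧
    ∀ (L : ℕ), 1 < L → ∀ (i : Idx L) (U₀ : GaugeField (i.1.1.P i.1.2.2) 0 (Matrix.specialUnitaryGroup (Fin 2) ℂ)), ∀ ρ : ℝ, RegPr i.1.1 i.1.2.1 i.1.2.2 ρ U₀ → ρ ≤ αH L →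
        (∀ cf : Site (i.1.1.P i.1.2.2) (i.1.2.2 - i.1.2.1) → Matrix (Fin 2) (Fin 2) ℂ,
        (∀ e' : PBond (i.1.1.P i.1.2.2) (i.1.2.2 - i.1.2.1), cf e'.src = ((emlIterU (i.1.2.2 - i.1.2.1) (bgUnits i.1.1 i.1.2.2 U₀) e' : (Matrix (Fin 2) (Fin 2) ℂ)ˣ) : Matrix (Fin 2) (Fin 2) ℂ) * cf e'.tgt *
        (((emlIterU (i.1.2.2 - i.1.2.1) (bgUnits i.1.1 i.1.2.2 U₀) e')⁻¹ : (Matrix (Fin 2) (Fin 2) ℂ)ˣ) : Matrix (Fin 2) (Fin 2) ℂ)) →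
        ∃ l₀ : Site (i.1.1.P i.1.2.2) 0 → Matrix (Fin 2) (Fin 2) ℂ,
        (∀ b' : PBond (i.1.1.P i.1.2.2) 0, l₀ b'.src = ((bgUnits i.1.1 i.1.2.2 U₀ b' : (Matrix (Fin 2) (Fin 2) ℂ)ˣ) : Matrix (Fin 2) (Fin 2) ℂ) * l₀ b'.tgt * (((bgUnits i.1.1 i.1.2.2 U₀ b')⁻¹ : (Matrix (Fin 2) (Fin 2) ℂ)ˣ) : Matrix (Fin 2) (Fin 2) ℂ)) ∧
        ∀ y : Site (i.1.1.P i.1.2.2) (i.1.2.2 - i.1.2.1), l₀ (embIter (i.1.2.2 - i.1.2.1) y) = cf y) →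
      2 * (12 * i.1.1.L ^ (i.1.2.2 - i.1.2.1) + 5) ≤ (i.1.1.P i.1.2.2).sitesPerDir 0 →
      ∀ a : ℝ, a₀ * (c₀ L / cB L) * ((i.1.1.L : ℝ) ^ (i.1.2.2 - i.1.2.1)) ^ 3 ≤ a → a ≤ a₁ * (c₀ L / cB L) * ((i.1.1.L : ℝ) ^ (i.1.2.2 - i.1.2.1)) ^ 3 →
      ∀ (y : PBond (i.1.1.P i.1.2.1) 0) (Z : Matrix (Fin 2) (Fin 2) ℂ) (b' : Bond 3 (periodsT3 i.1.1 i.1.2.2)),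
        ‖flat115 ((H1f i.1.1 i.1.2.1 i.1.2.2 i.2.2.le (c₀ L) (cB L) a (DeltaPiSlotP i.1.1 i.1.2.1 i.1.2.2 i.2.2.le (c₀ L) (cB L) a) U₀) (Pi.single y Z)) b'‖
          ≤ CH L * Real.exp (-(δH L / 2 * (Site.tdist (B5Eq118OneStroke.iterBlockOf (i.1.2.2 - i.1.2.1) ((bondEquiv i.1.1 i.1.2.2).symm b').src)
              (T3LevelShift.siteShift (T3PrintedRegularOrbits.sites_eq i.1.1 i.1.2.1 i.1.2.2 i.2.2.le) y.src) : ℝ))) * ‖Z‖ := by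
  classical
  obtain ⟨αPi, CPi, μPi, hαPi, hWPi12, hWPi10, hWPi13, hαPi1, hCPi, hμPi, hKπ⟩ := kinvRow_pi_family_exists c₀ cB ha₀ ha₀₁
  obtain ⟨αP, CP, KP, δP, hαP, hWP12, hWP10, hWP13, hCP, hKP, hδP, hP⟩ := hGblk_pi_family_exists c₀ cB ha₀ ha₀₁
  obtain ⟨αcp, γcp, hαcp, hWcp, hwincp, hγcp, hcp⟩ := hco_DeltaPiSlotP_exists c₀ cB ha₀
  set δ : ℕ → ℝ := fun L => min (μPi L) (δP L) with hδd
  have hδ0 : ∀ L : ℕ, 1 < L → 0 < δ L := fun L hL => by simp only [hδd]; exact lt_min (hμPi L hL) (hδP L hL)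
  have hδμ : ∀ L : ℕ, δ L ≤ μPi L := fun L => min_le_left _ _
  have hδP' : ∀ L : ℕ, δ L ≤ δP L := fun L => min_le_right _ _
  set αH : ℕ → ℝ := fun L => min (min (αPi L) (αP L)) (αcp L) with hαH
  have hαH0 : ∀ L : ℕ, 1 < L → 0 < αH L := fun L hL => by
    have := hαPi L hL; have := hαP L hL; have := hαcp L hL
    simp only [hαH]; exact lt_min (lt_min (by assumption) (by assumption)) (by assumption)
  have hαHPi : ∀ L, αH L ≤ αPi L := fun L => by simp only [hαH]; exact (min_le_left _ _).trans (min_le_left _ _)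
  have hαHP : ∀ L, αH L ≤ αP L := fun L => by simp only [hαH]; exact (min_le_left _ _).trans (min_le_right _ _)
  have hαHcp : ∀ L, αH L ≤ αcp L := fun L => by simp only [hαH]; exact min_le_right _ _
  have hW12 : ∀ L : ℕ, 1 < L → 10 ^ 12 * (L : ℝ) ^ 3 * αH L ≤ 1 := fun L hL => by
    have hL0 : (0 : ℝ) < L := by exact_mod_cast lt_trans zero_lt_one hL
    exact (mul_le_mul_of_nonneg_left (hαHPi L) (by positivity)).trans (hWPi12 L hL)
  have hW10 : ∀ L : ℕ, 1 < L → 10 ^ 10 * (L : ℝ) ^ 6 * αH L ≤ 1 := fun L hL => by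
    have hL0 : (0 : ℝ) < L := by exact_mod_cast lt_trans zero_lt_one hL
    exact (mul_le_mul_of_nonneg_left (hαHPi L) (by positivity)).trans (hWPi10 L hL)
  have hW13 : ∀ L : ℕ, 1 < L → 13 * 10 ^ 14 * (L : ℝ) ^ 3 * αH L ≤ 1 := fun L hL => by
    have hL0 : (0 : ℝ) < L := by exact_mod_cast lt_trans zero_lt_one hL
    exact (mul_le_mul_of_nonneg_left (hαHPi L) (by positivity)).trans (hWPi13 L hL)
  refine ⟨αH, fun L => 1920 * Real.exp (δ L + 1) * CPi L * CP L * (2 * (1 + 2 / δ L)) ^ 3, δ, hαH0, hW12, hW10, hW13,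
    fun L hL => (hαHPi L).trans (hαPi1 L hL), fun L hL => by have := hCPi L hL; have := hCP L hL; have := hδ0 L hL; positivity, hδ0, ?_⟩
  intro L hL i U₀ ρ hreg hρ hlift hroom a ha₀a ha₁a y Z b'
  -- the clamped coupling function
  obtain ⟨af, haf⟩ : ∃ f : ∀ L' : ℕ, Idx L' → ℝ, ∀ (L' : ℕ) (i' : Idx L'),
      f L' i' = max (a₀ * (c₀ L' / cB L') * ((i'.1.1.L : ℝ) ^ (i'.1.2.2 - i'.1.2.1)) ^ 3) (min a (a₁ * (c₀ L' / cB L') * ((i'.1.1.L : ℝ) ^ (i'.1.2.2 - i'.1.2.1)) ^ 3)) :=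
    ⟨_, fun _ _ => rfl⟩
  have ht0 : ∀ (L' : ℕ) (i' : Idx L'), 0 ≤ (c₀ L' / cB L') * ((i'.1.1.L : ℝ) ^ (i'.1.2.2 - i'.1.2.1)) ^ 3 := fun L' i' =>
    mul_nonneg (div_nonneg (hc₀ L').out.le (hcB L').out.le) (pow_nonneg (pow_nonneg (Nat.cast_nonneg _) _) _)
  have haf_lo : ∀ (L' : ℕ) (i' : Idx L'), a₀ * (c₀ L' / cB L') * ((i'.1.1.L : ℝ) ^ (i'.1.2.2 - i'.1.2.1)) ^ 3 ≤ af L' i' := fun L' i' => by rw [haf]; exact le_max_left _ _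
  have haf_hi : ∀ (L' : ℕ) (i' : Idx L'), af L' i' ≤ a₁ * (c₀ L' / cB L') * ((i'.1.1.L : ℝ) ^ (i'.1.2.2 - i'.1.2.1)) ^ 3 := fun L' i' => by
    rw [haf]
    refine max_le ?_ (min_le_right _ _)
    have := ht0 L' i'
    rw [mul_assoc, mul_assoc]; exact mul_le_mul_of_nonneg_right ha₀₁ this
  have hafa : af L i = a := by rw [haf, min_eq_left ha₁a, max_eq_right ha₀a]
  -- the thread
  obtain ⟨Λ, hΛ⟩ : ∃ Λ : ∀ (L' : ℕ) (i' : Idx L'), GaugeField (i'.1.1.P i'.1.2.2) 0 (Matrix.specialUnitaryGroup (Fin 2) ℂ) → Prop, ∀ L' i' U₀', Λ L' i' U₀' ↔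
      ((∀ cf : Site (i'.1.1.P i'.1.2.2) (i'.1.2.2 - i'.1.2.1) → Matrix (Fin 2) (Fin 2) ℂ,
        (∀ e' : PBond (i'.1.1.P i'.1.2.2) (i'.1.2.2 - i'.1.2.1), cf e'.src = ((emlIterU (i'.1.2.2 - i'.1.2.1) (bgUnits i'.1.1 i'.1.2.2 U₀') e' : (Matrix (Fin 2) (Fin 2) ℂ)ˣ) : Matrix (Fin 2) (Fin 2) ℂ) * cf e'.tgt *
        (((emlIterU (i'.1.2.2 - i'.1.2.1) (bgUnits i'.1.1 i'.1.2.2 U₀') e')⁻¹ : (Matrix (Fin 2) (Fin 2) ℂ)ˣ) : Matrix (Fin 2) (Fin 2) ℂ)) →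
        ∃ l₀ : Site (i'.1.1.P i'.1.2.2) 0 → Matrix (Fin 2) (Fin 2) ℂ,
        (∀ b' : PBond (i'.1.1.P i'.1.2.2) 0, l₀ b'.src = ((bgUnits i'.1.1 i'.1.2.2 U₀' b' : (Matrix (Fin 2) (Fin 2) ℂ)ˣ) : Matrix (Fin 2) (Fin 2) ℂ) * l₀ b'.tgt * (((bgUnits i'.1.1 i'.1.2.2 U₀' b')⁻¹ : (Matrix (Fin 2) (Fin 2) ℂ)ˣ) : Matrix (Fin 2) (Fin 2) ℂ)) ∧
        ∀ y : Site (i'.1.1.P i'.1.2.2) (i'.1.2.2 - i'.1.2.1), l₀ (embIter (i'.1.2.2 - i'.1.2.1) y) = cf y) ∧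
      2 * (12 * i'.1.1.L ^ (i'.1.2.2 - i'.1.2.1) + 5) ≤ (i'.1.1.P i'.1.2.2).sitesPerDir 0) := ⟨_, fun _ _ _ => Iff.rfl⟩
  -- the window of record at each member under the cap (for `posOnto_of_coercive`)
  have hw13 : ∀ (L' : ℕ), 1 < L' → ∀ (i' : Idx L') (ρ' : ℝ), ρ' ≤ αH L' → 13 * 10 ^ 14 * (i'.1.1.L : ℝ) ^ 3 * ρ' ≤ 1 := by
    intro L' hL' i' ρ' hρ'
    have e : (i'.1.1.L : ℝ) = (L' : ℝ) := by rw [i'.2.1]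
    have hL0 : (0 : ℝ) < L' := by exact_mod_cast lt_trans zero_lt_one hL'
    rw [e]
    calc 13 * 10 ^ 14 * (L' : ℝ) ^ 3 * ρ' ≤ 13 * 10 ^ 14 * (L' : ℝ) ^ 3 * αH L' := mul_le_mul_of_nonneg_left hρ' (by positivity)
      _ ≤ 1 := hW13 L' hL'
  -- the H-door
  have key := kernel133_family_of_kinvRow_of_greenBlockSup αH hαH0 hW10 hW12 c₀ cB af Λ
    (fun L' hL' i' U₀' ρ' hreg' hρ' hl' => posOnto_of_coercive i'.2.2.le (cB L') i'.2.2 hreg' (hw13 L' hL' i' ρ' hρ') (hγcp L' hL') _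
      (hcp L' hL' i' U₀' ρ' hreg' (hρ'.trans (hαHcp L')) ((hΛ L' i' U₀').mp hl').1 (af L' i') (haf_lo L' i')))
    CPi CP δ hCPi hCP hδ0
    (fun L' hL' i' U₀' ρ' hreg' hρ' hl' => coarseRow_mono_rate i'.2.2.le (cB L') _
      (mul_nonneg (hCPi L' hL') (by have hL0 : (0 : ℝ) < L' := Nat.cast_pos.mpr (lt_trans zero_lt_one hL'); have := (hc₀ L').out; have := (hcB L').out; positivity)) (hδμ L')
      (hKπ L' hL' i' U₀' ρ' hreg' (hρ'.trans (hαHPi L')) ((hΛ L' i' U₀').mp hl').1 ((hΛ L' i' U₀').mp hl').2 (af L' i') (haf_lo L' i') (haf_hi L' i')))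
    (fun L' hL' i' U₀' ρ' hreg' hρ' hl' =>
      blockLetter_mono_rate (fun b : PBond (i'.1.1.P i'.1.2.2) 0 => iterBlockOf (i'.1.2.2 - i'.1.2.1) b.src) (fun bd : PBond (i'.1.1.P i'.1.2.2) 0 => iterBlockOf (i'.1.2.2 - i'.1.2.1) bd.src)
        (fun X bd => (toL2 i'.1.1 i'.1.2.2 (c₀ L')).symm (GT i'.1.1 i'.1.2.1 i'.1.2.2 i'.2.2.le (c₀ L') (cB L') (af L' i')
          (DeltaPiSlotP i'.1.1 i'.1.2.1 i'.1.2.2 i'.2.2.le (c₀ L') (cB L') (af L' i')) U₀' (toL2 i'.1.1 i'.1.2.2 (c₀ L') X)) bd) (hCP L' hL') (hδP' L')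
        (hP L' hL' i' U₀' ρ' hreg' (hρ'.trans (hαHP L')) ((hΛ L' i' U₀').mp hl').1 ((hΛ L' i' U₀').mp hl').2 (af L' i') (haf_lo L' i') (haf_hi L' i')).1)
    L hL i U₀ ρ hreg hρ ((hΛ L i U₀).mpr ⟨hlift, hroom⟩) y Z b'
  rw [hafa] at key
  exact key

/-- ★★★ **THE S47 ROW `h137kπ` FOR ALL MEMBERS AS ONE `∃`-PACKAGE** — px10 g13's K3-door ✓p769218 §4 `kernel137_family_of_kinvRow` at `Δx := DeltaPiSlotP … a` fed K6-Π; the coupling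
pin `|a| ≤ a₁·((c₀ L∕cB L)·ℓ³)` is the window's upper edge; `c137 L := 1920·e^{μPi L+1}·(CPi L + a₁)`, rate `μPi L`. [cite: Balaban1985BackgroundPropagators, (3.132) p.422, (3.124)–(3.126) p.420;
Balaban1985Variational, (133), (137) p.298] -/
theorem h137kpi_family_exists (c₀ cB : ℕ → ℝ) [hc₀ : ∀ L : ℕ, Fact (0 < c₀ L)] [hcB : ∀ L : ℕ, Fact (0 < cB L)] {a₀ a₁ : ℝ} (ha₀ : 0 < a₀) (ha₀₁ : a₀ ≤ a₁) :
    ∃ (αH c137 δK : ℕ → ℝ),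
      (∀ L : ℕ, 1 < L → 0 < αH L) ∧ (∀ L : ℕ, 1 < L → 10 ^ 12 * (L : ℝ) ^ 3 * αH L ≤ 1) ∧ (∀ L : ℕ, 1 < L → 10 ^ 10 * (L : ℝ) ^ 6 * αH L ≤ 1) ∧
      (∀ L : ℕ, 1 < L → 13 * 10 ^ 14 * (L : ℝ) ^ 3 * αH L ≤ 1) ∧ (∀ L : ℕ, 1 < L → αH L ≤ 1) ∧ (∀ L : ℕ, 1 < L → 0 ≤ c137 L) ∧ (∀ L : ℕ, 1 < L → 0 < δK L) ∧
    ∀ (L : ℕ), 1 < L → ∀ (i : Idx L) (U₀ : GaugeField (i.1.1.P i.1.2.2) 0 (Matrix.specialUnitaryGroup (Fin 2) ℂ)), ∀ ρ : ℝ, RegPr i.1.1 i.1.2.1 i.1.2.2 ρ U₀ → ρ ≤ αH L →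
        (∀ cf : Site (i.1.1.P i.1.2.2) (i.1.2.2 - i.1.2.1) → Matrix (Fin 2) (Fin 2) ℂ,
        (∀ e' : PBond (i.1.1.P i.1.2.2) (i.1.2.2 - i.1.2.1), cf e'.src = ((emlIterU (i.1.2.2 - i.1.2.1) (bgUnits i.1.1 i.1.2.2 U₀) e' : (Matrix (Fin 2) (Fin 2) ℂ)ˣ) : Matrix (Fin 2) (Fin 2) ℂ) * cf e'.tgt *
        (((emlIterU (i.1.2.2 - i.1.2.1) (bgUnits i.1.1 i.1.2.2 U₀) e')⁻¹ : (Matrix (Fin 2) (Fin 2) ℂ)ˣ) : Matrix (Fin 2) (Fin 2) ℂ)) →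
        ∃ l₀ : Site (i.1.1.P i.1.2.2) 0 → Matrix (Fin 2) (Fin 2) ℂ,
        (∀ b' : PBond (i.1.1.P i.1.2.2) 0, l₀ b'.src = ((bgUnits i.1.1 i.1.2.2 U₀ b' : (Matrix (Fin 2) (Fin 2) ℂ)ˣ) : Matrix (Fin 2) (Fin 2) ℂ) * l₀ b'.tgt * (((bgUnits i.1.1 i.1.2.2 U₀ b')⁻¹ : (Matrix (Fin 2) (Fin 2) ℂ)ˣ) : Matrix (Fin 2) (Fin 2) ℂ)) ∧
        ∀ y : Site (i.1.1.P i.1.2.2) (i.1.2.2 - i.1.2.1), l₀ (embIter (i.1.2.2 - i.1.2.1) y) = cf y) →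
      2 * (12 * i.1.1.L ^ (i.1.2.2 - i.1.2.1) + 5) ≤ (i.1.1.P i.1.2.2).sitesPerDir 0 →
      ∀ a : ℝ, a₀ * (c₀ L / cB L) * ((i.1.1.L : ℝ) ^ (i.1.2.2 - i.1.2.1)) ^ 3 ≤ a → a ≤ a₁ * (c₀ L / cB L) * ((i.1.1.L : ℝ) ^ (i.1.2.2 - i.1.2.1)) ^ 3 →
      ∀ (y : PBond (i.1.1.P i.1.2.1) 0) (Z : Matrix (Fin 2) (Fin 2) ℂ) (b : PBond (i.1.1.P i.1.2.2) 0),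
        ‖(toL2 i.1.1 i.1.2.2 (c₀ L)).symm (LinearMap.adjoint (Qk i.1.1 i.1.2.1 i.1.2.2 i.2.2.le (c₀ L) (cB L) U₀) (KinvT i.1.1 i.1.2.1 i.1.2.2 i.2.2.le (c₀ L) (cB L) a
              (DeltaPiSlotP i.1.1 i.1.2.1 i.1.2.2 i.2.2.le (c₀ L) (cB L) a) U₀ (toL2B i.1.1 i.1.2.1 (cB L) (Pi.single y Z)))
            - LinearMap.adjoint (Qk i.1.1 i.1.2.1 i.1.2.2 i.2.2.le (c₀ L) (cB L) U₀) (((a : ℂ)) • toL2B i.1.1 i.1.2.1 (cB L) (Pi.single y Z))) b‖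
          ≤ c137 L * Real.exp (-(δK L * (Site.tdist (iterBlockOf (i.1.2.2 - i.1.2.1) b.src) (siteShift (sites_eq i.1.1 i.1.2.1 i.1.2.2 i.2.2.le) y.src) : ℝ))) * ‖Z‖ := by
  classical
  obtain ⟨αPi, CPi, μPi, hαPi, hWPi12, hWPi10, hWPi13, hαPi1, hCPi, hμPi, hKπ⟩ := kinvRow_pi_family_exists c₀ cB ha₀ ha₀₁
  have ha₁ : 0 ≤ a₁ := ha₀.le.trans ha₀₁
  refine ⟨αPi, fun L => 1920 * Real.exp (μPi L + 1) * (CPi L + a₁), μPi, hαPi, hWPi12, hWPi10, hWPi13, hαPi1,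
    fun L hL => by have := hCPi L hL; positivity, hμPi, ?_⟩
  intro L hL i U₀ ρ hreg hρ hlift hroom a ha₀a ha₁a y Z b
  -- the clamped coupling function
  obtain ⟨af, haf⟩ : ∃ f : ∀ L' : ℕ, Idx L' → ℝ, ∀ (L' : ℕ) (i' : Idx L'),
      f L' i' = max (a₀ * (c₀ L' / cB L') * ((i'.1.1.L : ℝ) ^ (i'.1.2.2 - i'.1.2.1)) ^ 3) (min a (a₁ * (c₀ L' / cB L') * ((i'.1.1.L : ℝ) ^ (i'.1.2.2 - i'.1.2.1)) ^ 3)) :=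
    ⟨_, fun _ _ => rfl⟩
  have ht0 : ∀ (L' : ℕ) (i' : Idx L'), 0 ≤ (c₀ L' / cB L') * ((i'.1.1.L : ℝ) ^ (i'.1.2.2 - i'.1.2.1)) ^ 3 := fun L' i' =>
    mul_nonneg (div_nonneg (hc₀ L').out.le (hcB L').out.le) (pow_nonneg (pow_nonneg (Nat.cast_nonneg _) _) _)
  have haf_lo : ∀ (L' : ℕ) (i' : Idx L'), a₀ * (c₀ L' / cB L') * ((i'.1.1.L : ℝ) ^ (i'.1.2.2 - i'.1.2.1)) ^ 3 ≤ af L' i' := fun L' i' => by rw [haf]; exact le_max_left _ _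
  have haf_hi : ∀ (L' : ℕ) (i' : Idx L'), af L' i' ≤ a₁ * (c₀ L' / cB L') * ((i'.1.1.L : ℝ) ^ (i'.1.2.2 - i'.1.2.1)) ^ 3 := fun L' i' => by
    rw [haf]
    refine max_le ?_ (min_le_right _ _)
    have := ht0 L' i'
    rw [mul_assoc, mul_assoc]; exact mul_le_mul_of_nonneg_right ha₀₁ this
  have hafa : af L i = a := by rw [haf, min_eq_left ha₁a, max_eq_right ha₀a]
  have haf0 : ∀ (L' : ℕ) (i' : Idx L'), 0 ≤ af L' i' := fun L' i' => le_trans (by have := ht0 L' i'; rw [mul_assoc]; positivity) (haf_lo L' i')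
  have hafU : ∀ (L' : ℕ), 1 < L' → ∀ i' : Idx L', |af L' i'| ≤ a₁ * ((c₀ L' / cB L') * ((L' : ℝ) ^ (i'.1.2.2 - i'.1.2.1)) ^ 3) := fun L' _ i' => by
    have e : (i'.1.1.L : ℝ) = (L' : ℝ) := by rw [i'.2.1]
    have := haf_hi L' i'
    rw [e, mul_assoc] at this; rw [abs_of_nonneg (haf0 L' i')]; exact this
  -- the thread
  obtain ⟨Λ, hΛ⟩ : ∃ Λ : ∀ (L' : ℕ) (i' : Idx L'), GaugeField (i'.1.1.P i'.1.2.2) 0 (Matrix.specialUnitaryGroup (Fin 2) ℂ) → Prop, ∀ L' i' U₀', Λ L' i' U₀' ↔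
      ((∀ cf : Site (i'.1.1.P i'.1.2.2) (i'.1.2.2 - i'.1.2.1) → Matrix (Fin 2) (Fin 2) ℂ,
        (∀ e' : PBond (i'.1.1.P i'.1.2.2) (i'.1.2.2 - i'.1.2.1), cf e'.src = ((emlIterU (i'.1.2.2 - i'.1.2.1) (bgUnits i'.1.1 i'.1.2.2 U₀') e' : (Matrix (Fin 2) (Fin 2) ℂ)ˣ) : Matrix (Fin 2) (Fin 2) ℂ) * cf e'.tgt *
        (((emlIterU (i'.1.2.2 - i'.1.2.1) (bgUnits i'.1.1 i'.1.2.2 U₀') e')⁻¹ : (Matrix (Fin 2) (Fin 2) ℂ)ˣ) : Matrix (Fin 2) (Fin 2) ℂ)) →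
        ∃ l₀ : Site (i'.1.1.P i'.1.2.2) 0 → Matrix (Fin 2) (Fin 2) ℂ,
        (∀ b' : PBond (i'.1.1.P i'.1.2.2) 0, l₀ b'.src = ((bgUnits i'.1.1 i'.1.2.2 U₀' b' : (Matrix (Fin 2) (Fin 2) ℂ)ˣ) : Matrix (Fin 2) (Fin 2) ℂ) * l₀ b'.tgt * (((bgUnits i'.1.1 i'.1.2.2 U₀' b')⁻¹ : (Matrix (Fin 2) (Fin 2) ℂ)ˣ) : Matrix (Fin 2) (Fin 2) ℂ)) ∧
        ∀ y : Site (i'.1.1.P i'.1.2.2) (i'.1.2.2 - i'.1.2.1), l₀ (embIter (i'.1.2.2 - i'.1.2.1) y) = cf y) ∧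
      2 * (12 * i'.1.1.L ^ (i'.1.2.2 - i'.1.2.1) + 5) ≤ (i'.1.1.P i'.1.2.2).sitesPerDir 0) := ⟨_, fun _ _ _ => Iff.rfl⟩
  have key := kernel137_family_of_kinvRow αPi hαPi hWPi10 hWPi12 c₀ cB af (fun _ => a₁) (fun _ _ => ha₁) hafU
    (fun L' i' => DeltaPiSlotP i'.1.1 i'.1.2.1 i'.1.2.2 i'.2.2.le (c₀ L') (cB L') (af L' i')) Λ CPi μPi hCPi hμPi
    (fun L' hL' i' U₀' ρ' hreg' hρ' hl' => hKπ L' hL' i' U₀' ρ' hreg' hρ' ((hΛ L' i' U₀').mp hl').1 ((hΛ L' i' U₀').mp hl').2 (af L' i') (haf_lo L' i') (haf_hi L' i'))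
    L hL i U₀ ρ hreg hρ ((hΛ L i U₀).mpr ⟨hlift, hroom⟩) y Z b
  rw [hafa] at key
  exact key

end Summit.QuantumFields.YangMills.Theorems.Prop7H133FamilyPackage

end
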